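import Mathlib.LinearAlgebra.Matrix.Basis
import Mathlib.LinearAlgebra.Multilinear.Basis
import Literature.Geometry.Hyperkaehler.Hyperholomorphic
import HarnessLib

/-!
# Verbitsky's Lemma 2.1 and Theorem 2.3: a hyperholomorphic connection is Yang–Mills (`ΛΘ = 0`),
# and the surface criterion in the proof of Theorem 2.4

Layer `Literature/Geometry/Hyperkaehler`, namespace `Literature.Geometry.Hyperkaehler` (with the
`metricTrace` infrastructure of §1 in `Literature.Geometry.Kaehler`, next to its definition); lane
`lit-hodgefound` (Track 2 foundations library), p06's self-proposed row g13-#1 of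
`run/shared/lean/pub/lit-hodgefound/SKELETON.md`. Sequel of `Hyperholomorphic.lean` (the DEFINITIONS
`IsSU2InvariantAt`, `UnitaryConnection.IsHyperholomorphic`, `HermitianHolomorphicBundle.IsHyperholomorphic`,
whose docstring lists "Thm. 2.3 (hyperholomorphic ⇒ Yang–Mills, `Λ_L Θ = 0`)" under "What is NOT here"):
the present file PROVES that theorem on the tree's carriers. THEOREMS ONLY; no definition, no named fact
(net debt `0`).

## Source, verbatim (held copies)

M. Verbitsky, *Hyperholomorphic bundles over a hyperkähler manifold*, J. Alg. Geom. **5** (1996)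
633–669 = alg-geom/9307008, §2 (held `paper:arxiv-alg-geom_9307008`, p. 3):

* **Theorem 2.3** (L11–L13): "A hyperholomorphic connection in a bundle B is Yang-Mills. Moreover,
  for such connection `Λ(Θ) = 0` where `Θ` is a curvature in `B`."
* **Lemma 2.1** (L17–L21): "Let `Θ` be a `G_M`-invariant section of `Λ²(M) ⊗ End(B)`. Then
  `Λ_L(Θ) = 0` for each induced complex structure `L`. By `Λ_L` we understand the Hodge operator
  `Λ` associated with the Kähler complex structure `L`." Proof (L23–L55): the span `R` of the Kähler
  forms `ω_L` is `G_M`-stable and contains no invariant vector, hence is orthogonal to the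
  `G_M`-invariants; "by the definition of the Hodge operator `Λ_L`, for `G_M`-invariant `Θ`,
  `Λ_L(Θ) = 0` because the Kähler form `ω_L` is orthogonal to `Θ`."
* **Proof of Theorem 2.4** (`M` a hyperkähler surface, K3 or abelian surface; L61–L93): "The space of
  complex 2-forms over `M` has a trivial 3-dimensional subbundle `P` spanned by Kähler form,
  holomorphic symplectic form and the form conjugated to the holomorphic symplectic form. Let `P^⊥`
  be its orthogonal completion. One easily sees that if `M` is a surface then `P^⊥` is a bundle of
  `G_M`-invariant 2-forms. On the other hand, the curvature `Θ` of a Yang-Mills bundle of degree zero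
  is orthogonal to `P` […] First, `Θ` is of type `(1,1)` […] Second, `Λ(Θ) = 0` is equivalent to `Θ`
  being orthogonal to the Kähler form by definition of `Λ`." "`P` is identical to `Λ⁺(M)` and `P^⊥` is
  `Λ⁻(M)`."

Restated: M. Verbitsky, *Hyperholomorphic sheaves and new examples of hyperkähler manifolds*,
alg-geom/9712012, §3.3 (held `paper:arxiv-alg-geom_9712012`, p. 10 L89–L107: "every hyperholomorphic
connection `∇` in `B` is Yang-Mills and satisfies `Λ(Θ) = 0`", "Let `Θ ∈ Λ²(M)` be a `SU(2)`-invariant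
differential 2-form on `M`. Then `Λ_L(Θ) = 0` for each induced complex structure `L`. Proof: This is
Lemma 2.1 of [V]"); V. Muñoz, *On rotation of complex structures*, J. Geom. Phys. 87 (2015), §3.1
(held `paper:arxiv-1307.8000`, p. 5: on a hyperkähler 4-manifold
"`Λ² = Λ²₊ ⊕ Λ²₋ = ⟨ω_I, ω_J, ω_K⟩ ⊕ Δ^{1,1}_{I,prim}` […] If `λ = 0`, then `F_A ∈ Λ^{1,1}_{I,prim}(End E)`,
so `F_A ∈ Λ^{1,1}_{L,prim}(End E)` for any `L` […] Such bundle `E` is called hyperholomorphic in the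
terminology of [Verbitsky]").

## Lean rendering (pointwise linear algebra on `T_x M`, then the tree's connection carriers)

Setting: a complex manifold `M` modelled on `E` (`I = tangentJ E`), a Riemannian metric `g` and
endomorphism fields `J, K` with `IsHyperkaehlerTriple g J K` (`HyperkaehlerManifold.lean`); `β` a
`W`-valued `2`-covector on `T_x M` (`W` any real normed space: `ℝ`, `ℂ`, `End F`). The Hodge operator
`Λ_L` on `2`-forms is, up to the factor `½`, the METRIC TRACE `tr_g β(·, L·)` (the tree's
`metricTrace`, `HermitianHolomorphicBundleMeanCurvature.lean`; `MForm.contractKaehler g β = ½ tr_g β(·, I·)`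
is the tree's `Λ` for `I`, on which Kobayashi's mean curvature `K = iΛΩ` of the tree is built).

* §1 (namespace `Literature.Geometry.Kaehler`) — infrastructure the tree's `metricTrace` lacked (only
  `metricTrace_zero/_inner` existed): the inverse-Gram contraction `Σ (G⁻¹)ᵢⱼ b(uᵢ, uⱼ)` does not
  depend on the basis (`sum_inv_gram_smul_eq_of_basis`, pure linear algebra; `metricTrace_eq_sum_basis`),
  equals `Σₖ b(fₖ, fₖ)` in an orthonormal basis (`metricTrace_eq_sum_of_orthonormal` — the property
  announced in the docstring of `metricTrace`), and is invariant under `g_x`-isometries of `T_x M`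
  (`metricTrace_comp_of_inner_map_map`).
* §2 **Lemma 2.1**, pointwise: `metricTrace_apply₂_eq_zero_of_anticommute` (the mechanism: a
  `g_x`-isometry `A` anticommuting with `L` and preserving `β` forces `tr_g β(·, L·) = −tr_g β(·, L·)`),
  `IsSU2InvariantAt.metricTrace_tangentJ_eq_zero / _J_ / _K_ / metricTrace_inducedJ_eq_zero`
  (**`Λ_L β = 0` for EVERY `L = aI + bJ + cK`**), `IsSU2InvariantAt.contractKaehler_eq_zero` (the
  tree's `Λ`), and `IsSU2InvariantAt.zeroTwoPart_apply_eq_zero` (an invariant form has no `(0,2)`-part).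
* §3 **Theorem 2.3** on the tree's carriers: `UnitaryConnection.IsHyperholomorphic.meanCurvature_eq_zero`
  (`K = iΛΩ = 0`), `…scalarCurvature_eq_zero`, `…einsteinDefectNormSq_zero_eq_zero`,
  `…curvatureZeroTwoNormSq_eq_zero`, `…einsteinConstant_eq_zero`, **`…holomorphicDefect_eq_zero`**
  (`‖Ω^{0,2}‖² + ‖K − cI‖² = 0`: integrable and Einstein–Hermitian with `c = 0`),
  `HermitianStructure.isApproxHermitianYangMills_of_isHyperholomorphic`, and for Chern connections
  **`HermitianHolomorphicBundle.IsHyperholomorphic.isHermitianEinstein_zero`** (`IsHermitianEinstein g 0`).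
* §4 **the surface criterion** (`dim_ℂ M = 2`): `IsHyperkaehlerTriple.exists_quaternionic_orthonormal_basis`
  (a `g_x`-orthonormal frame `(e, Ie, Je, Ke)`), **`IsHyperkaehlerTriple.isSU2InvariantAt_iff_of_finrank_eq_two`**
  (`SU(2)`-invariant ⟺ `(1,1)` for `I` and `Λ_I = 0`), and
  **`HermitianHolomorphicBundle.isHyperholomorphic_iff_isHermitianEinstein_zero`** (on a hyperkähler
  surface: hyperholomorphic ⟺ Einstein–Hermitian with constant `0`; Thm. 2.4 minus Uhlenbeck–Yau).

Normalisations: Verbitsky's "Yang–Mills with `Λ(Θ) = 0`" is Kobayashi's Einstein–Hermitian condition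
with constant `0` (IV.§1), the tree's `IsHermitianEinstein g 0` / `meanCurvature = 0`; the factor `i/2`
of the tree's `K = (i/2)·contractKaehler` is immaterial for vanishing.

## What is NOT here

Uhlenbeck–Yau (Thm. 2.2) and hence the existence half of Thm. 2.4; Thm. 2.5 (stable with invariant
`c₁, c₂` ⇒ hyperholomorphic); the `SU(2)`-action on forms of higher degree and on cohomology; the Hodge
star of an ORIENTED Riemannian `4`-manifold (`Geometry/GaugeTheory/SelfDualPart`: `Λ² = Λ²₊ ⊕ Λ²₋` on
the `ℝ⁴`-modelled carrier with positive frames — Verbitsky's remark "`P = Λ⁺`, `P^⊥ = Λ⁻`" is quoted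
above, not restated on either carrier).

## References

* [Verbitsky1996Hyperholomorphic] M. Verbitsky, Hyperholomorphic bundles over a hyperkähler manifold,
  J. Alg. Geom. 5 (1996) 633–669 = alg-geom/9307008: Lemma 2.1, Thm. 2.3, Thm. 2.4 (read, p. 3).
* [Verbitsky1997HyperholomorphicSheaves] M. Verbitsky, Hyperholomorphic sheaves and new examples of
  hyperkähler manifolds, alg-geom/9712012, §3.3 (read, p. 10).
* [Munoz2015RotationComplexStructures] V. Muñoz, On rotation of complex structures, J. Geom. Phys. 87
  (2015) 344–353 = arXiv:1307.8000, §3.1 (read, p. 5).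
* [Kobayashi1987] S. Kobayashi, Differential Geometry of Complex Vector Bundles, III.(1.6), IV.§1.
-/

noncomputable section

open scoped Manifold ContDiff Topology
open Bundle Module Finset

/-! ## §1 Infrastructure for the tree's metric trace `metricTrace` -/

namespace Literature.Geometry.Kaehler

/-! ### §1.1 Pure linear algebra: the inverse-Gram contraction does not depend on the basis -/

section PureLinearAlgebra

variable {T : Type*} [AddCommGroup T] [Module ℝ T] {W : Type*} [AddCommGroup W] [Module ℝ W]
  {ι κ : Type*} [Fintype ι] [Fintype κ]

/-- Expansion of a bilinear map on two finite linear combinations. [folklore] -/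
private theorem bilin_apply_sum_smul_sum_smul (b : T →ₗ[ℝ] T →ₗ[ℝ] W) (c : ι → ℝ) (d : κ → ℝ)
    (y : ι → T) (z : κ → T) :
    b (∑ i, c i • y i) (∑ k, d k • z k) = ∑ i, ∑ k, (c i * d k) • b (y i) (z k) := by
  rw [map_sum, Finset.sum_comm]
  refine Finset.sum_congr rfl fun k _ ↦ ?_
  rw [map_smul, map_sum, LinearMap.sum_apply, Finset.smul_sum]
  refine Finset.sum_congr rfl fun i _ ↦ ?_
  rw [map_smul, LinearMap.smul_apply, smul_smul, mul_comm]

variable [DecidableEq ι] [DecidableEq κ]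

/-- **Change of basis for the inverse-Gram contraction.** For a bilinear form `B` on `T` whose
Gram matrix in the basis `v` is invertible, a second basis `u`, and a bilinear `W`-valued map
`b`: `Σⱼₖ (G_v⁻¹)ⱼₖ b(vⱼ, vₖ) = Σᵢₗ (G_u⁻¹)ᵢₗ b(uᵢ, uₗ)`. (With `P` the `u`-coordinates of the `vⱼ`
and `Q` its inverse: `G_u = ᵗQ G_v Q`, and `P G_v⁻¹ ᵗP` is the inverse of `G_u`.) This is the
frame-independence underlying Kobayashi's contractions `Σ g^{αβ̄}(…)_{αβ̄}` written in an arbitrary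
local frame. [cite: Kobayashi1987, III.(1.6)] -/
theorem sum_inv_gram_smul_eq_of_basis (B : T →ₗ[ℝ] T →ₗ[ℝ] ℝ) (b : T →ₗ[ℝ] T →ₗ[ℝ] W)
    (v : Basis κ ℝ T) (u : Basis ι ℝ T) (hv : IsUnit (Matrix.of fun j k ↦ B (v j) (v k)).det) :
    ∑ j, ∑ k, (Matrix.of fun j k ↦ B (v j) (v k))⁻¹ j k • b (v j) (v k) =
      ∑ i, ∑ l, (Matrix.of fun i l ↦ B (u i) (u l))⁻¹ i l • b (u i) (u l) := by
  -- coordinates of each basis in the other one, as FUNCTIONS (`p i j = P i j`, `q j i = Q j i`)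
  obtain ⟨p, hp⟩ : ∃ f : ι → κ → ℝ, ∀ i j, u.repr (v j) i = f i j := ⟨_, fun _ _ ↦ rfl⟩
  obtain ⟨q, hq⟩ : ∃ f : κ → ι → ℝ, ∀ j i, v.repr (u i) j = f j i := ⟨_, fun _ _ ↦ rfl⟩
  set P : Matrix ι κ ℝ := u.toMatrix v with hP
  set Q : Matrix κ ι ℝ := v.toMatrix u with hQ
  have hPp : ∀ i j, P i j = p i j := fun i j ↦ hp i j
  have hQq : ∀ j i, Q j i = q j i := fun j i ↦ hq j i
  have hPQ : P * Q = 1 := u.toMatrix_mul_toMatrix_flip v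
  have hQP : Q * P = 1 := v.toMatrix_mul_toMatrix_flip u
  set Gv : Matrix κ κ ℝ := Matrix.of fun j k ↦ B (v j) (v k) with hGv
  set Gu : Matrix ι ι ℝ := Matrix.of fun i l ↦ B (u i) (u l) with hGu
  obtain ⟨gvi, hgvi⟩ : ∃ f : κ → κ → ℝ, ∀ j k, Gv⁻¹ j k = f j k := ⟨_, fun _ _ ↦ rfl⟩
  have hv_exp : ∀ j, v j = ∑ i, p i j • u i := fun j ↦ by
    conv_lhs => rw [← u.sum_repr (v j)]
    simp only [hp]
  have hu_exp : ∀ i, u i = ∑ j, q j i • v j := fun i ↦ by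
    conv_lhs => rw [← v.sum_repr (u i)]
    simp only [hq]
  -- the Gram matrices: `G_u = ᵗQ G_v Q`
  have hGram : Gu = Q.transpose * Gv * Q := by
    ext i l
    have h1 : B (u i) (u l) = ∑ j, ∑ k, (q j i * q k l) • B (v j) (v k) := by
      rw [hu_exp i, hu_exp l]
      exact bilin_apply_sum_smul_sum_smul B _ _ _ _
    rw [hGu, Matrix.of_apply, h1]
    simp only [Matrix.mul_apply, Matrix.transpose_apply, hQq, hGv, Matrix.of_apply, smul_eq_mul,
      Finset.sum_mul]
    rw [Finset.sum_comm]
    exact Finset.sum_congr rfl fun k _ ↦ Finset.sum_congr rfl fun j _ ↦ by ring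
  -- `P G_v⁻¹ ᵗP` is the inverse of `G_u`
  have hinv : Gu⁻¹ = P * Gv⁻¹ * P.transpose := by
    refine Matrix.inv_eq_right_inv ?_
    rw [hGram]
    calc Q.transpose * Gv * Q * (P * Gv⁻¹ * P.transpose)
        = Q.transpose * Gv * (Q * P) * Gv⁻¹ * P.transpose := by
          simp only [Matrix.mul_assoc]
      _ = Q.transpose * (Gv * Gv⁻¹) * P.transpose := by
          rw [hQP, Matrix.mul_one, Matrix.mul_assoc Q.transpose]
      _ = (P * Q).transpose := by
          rw [Matrix.mul_nonsing_inv _ hv, Matrix.mul_one, Matrix.transpose_mul]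
      _ = 1 := by rw [hPQ, Matrix.transpose_one]
  -- the left-hand side, expanded in the basis `u`
  have hL : ∑ j, ∑ k, gvi j k • b (v j) (v k) =
      ∑ i, ∑ l, (∑ j, ∑ k, p i j * gvi j k * p l k) • b (u i) (u l) := by
    calc ∑ j, ∑ k, gvi j k • b (v j) (v k)
        = ∑ j, ∑ k, ∑ i, ∑ l, (gvi j k * (p i j * p l k)) • b (u i) (u l) := by
          refine Finset.sum_congr rfl fun j _ ↦ Finset.sum_congr rfl fun k _ ↦ ?_
          rw [hv_exp j, hv_exp k, bilin_apply_sum_smul_sum_smul, Finset.smul_sum]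
          refine Finset.sum_congr rfl fun i _ ↦ ?_
          rw [Finset.smul_sum]
          exact Finset.sum_congr rfl fun l _ ↦ smul_smul _ _ _
      _ = ∑ j, ∑ i, ∑ k, ∑ l, (gvi j k * (p i j * p l k)) • b (u i) (u l) :=
          Finset.sum_congr rfl fun j _ ↦ Finset.sum_comm
      _ = ∑ i, ∑ j, ∑ k, ∑ l, (gvi j k * (p i j * p l k)) • b (u i) (u l) := Finset.sum_comm
      _ = ∑ i, ∑ j, ∑ l, ∑ k, (gvi j k * (p i j * p l k)) • b (u i) (u l) :=
          Finset.sum_congr rfl fun i _ ↦ Finset.sum_congr rfl fun j _ ↦ Finset.sum_comm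
      _ = ∑ i, ∑ l, ∑ j, ∑ k, (gvi j k * (p i j * p l k)) • b (u i) (u l) :=
          Finset.sum_congr rfl fun i _ ↦ Finset.sum_comm
      _ = ∑ i, ∑ l, (∑ j, ∑ k, p i j * gvi j k * p l k) • b (u i) (u l) := by
          refine Finset.sum_congr rfl fun i _ ↦ Finset.sum_congr rfl fun l _ ↦ ?_
          rw [Finset.sum_smul]
          refine Finset.sum_congr rfl fun j _ ↦ ?_
          rw [Finset.sum_smul]
          exact Finset.sum_congr rfl fun k _ ↦ by ring_nf
  have hfold : ∑ j, ∑ k, Gv⁻¹ j k • b (v j) (v k) = ∑ j, ∑ k, gvi j k • b (v j) (v k) := by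
    simp only [hgvi]
  rw [hfold, hL, hinv]
  refine Finset.sum_congr rfl fun i _ ↦ Finset.sum_congr rfl fun l _ ↦ ?_
  congr 1
  simp only [Matrix.mul_apply, Matrix.transpose_apply, hPp, hgvi, Finset.sum_mul]
  rw [Finset.sum_comm]

/-- In a basis `u` which is ORTHONORMAL for `B` the contraction is the plain sum `Σᵢ b(uᵢ, uᵢ)`
(Kobayashi's contractions in a unitary frame, `g_{αβ̄} = δ_{αβ}`). [cite: Kobayashi1987, III.(1.6)] -/
theorem sum_inv_gram_smul_eq_sum_of_orthonormal (B : T →ₗ[ℝ] T →ₗ[ℝ] ℝ) (b : T →ₗ[ℝ] T →ₗ[ℝ] W)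
    (v : Basis κ ℝ T) (u : Basis ι ℝ T) (hv : IsUnit (Matrix.of fun j k ↦ B (v j) (v k)).det)
    (hu : ∀ i l, B (u i) (u l) = if i = l then 1 else 0) :
    ∑ j, ∑ k, (Matrix.of fun j k ↦ B (v j) (v k))⁻¹ j k • b (v j) (v k) = ∑ i, b (u i) (u i) := by
  rw [sum_inv_gram_smul_eq_of_basis B b v u hv]
  have hG : (Matrix.of fun i l ↦ B (u i) (u l)) = 1 := by
    ext i l
    rw [Matrix.of_apply, hu, Matrix.one_apply]
  rw [hG, inv_one]
  refine Finset.sum_congr rfl fun i _ ↦ ?_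
  simp only [Matrix.one_apply, ite_smul, one_smul, zero_smul, Finset.sum_ite_eq, Finset.mem_univ,
    if_true]

/-- The contraction is invariant under a `B`-isometric automorphism `A` of `T`:
`Σⱼₖ (G_v⁻¹)ⱼₖ b(Avⱼ, Avₖ) = Σⱼₖ (G_v⁻¹)ⱼₖ b(vⱼ, vₖ)` (the family `(Avⱼ)` is a basis with the
same Gram matrix; frame-independence of the contraction). [cite: Kobayashi1987, III.(1.6)] -/
theorem sum_inv_gram_smul_map_eq (B : T →ₗ[ℝ] T →ₗ[ℝ] ℝ) (b : T →ₗ[ℝ] T →ₗ[ℝ] W)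
    (v : Basis κ ℝ T) (hv : IsUnit (Matrix.of fun j k ↦ B (v j) (v k)).det) (A : T ≃ₗ[ℝ] T)
    (hA : ∀ y z, B (A y) (A z) = B y z) :
    ∑ j, ∑ k, (Matrix.of fun j k ↦ B (v j) (v k))⁻¹ j k • b (A (v j)) (A (v k)) =
      ∑ j, ∑ k, (Matrix.of fun j k ↦ B (v j) (v k))⁻¹ j k • b (v j) (v k) := by
  rw [sum_inv_gram_smul_eq_of_basis B b v (v.map A) hv]
  simp only [Basis.map_apply, hA]

end PureLinearAlgebra

/-! ### §1.2 The metric trace of a Riemannian metric on a complex manifold -/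

section MetricTraceBasis

variable {E : Type*} [NormedAddCommGroup E] [NormedSpace ℂ E] [FiniteDimensional ℂ E]
  {M : Type*} [TopologicalSpace M] [ChartedSpace E M]
  {W : Type*} [NormedAddCommGroup W] [NormedSpace ℝ W]

/-- The metric trace is additive in the bilinear map. [folklore] -/
private theorem metricTrace_add (g : RiemannianMetric fun x : M ↦ TangentSpace 𝓘(ℝ, E) x) (x : M)
    (b c : TangentSpace 𝓘(ℝ, E) x → TangentSpace 𝓘(ℝ, E) x → W) :
    metricTrace g x (fun v w ↦ b v w + c v w) = metricTrace g x b + metricTrace g x c := by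
  simp only [metricTrace, smul_add, Finset.sum_add_distrib]

/-- The metric trace is homogeneous in the bilinear map. [folklore] -/
private theorem metricTrace_smul (g : RiemannianMetric fun x : M ↦ TangentSpace 𝓘(ℝ, E) x) (x : M)
    (r : ℝ) (b : TangentSpace 𝓘(ℝ, E) x → TangentSpace 𝓘(ℝ, E) x → W) :
    metricTrace g x (fun v w ↦ r • b v w) = r • metricTrace g x b := by
  simp only [metricTrace, Finset.smul_sum, smul_comm r]

/-- The metric trace of `-b` is `-(tr_g b)`. [folklore] -/
private theorem metricTrace_neg (g : RiemannianMetric fun x : M ↦ TangentSpace 𝓘(ℝ, E) x) (x : M)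
    (b : TangentSpace 𝓘(ℝ, E) x → TangentSpace 𝓘(ℝ, E) x → W) :
    metricTrace g x (fun v w ↦ -b v w) = -metricTrace g x b := by
  simp only [metricTrace, smul_neg, Finset.sum_neg_distrib]

omit [FiniteDimensional ℂ E] in
/-- The metric `g_x` as a bilinear map on `T_x M` (auxiliary packaging, no new content). [folklore] -/
private theorem exists_bilin_inner (g : RiemannianMetric fun x : M ↦ TangentSpace 𝓘(ℝ, E) x) (x : M) :
    ∃ B : TangentSpace 𝓘(ℝ, E) x →ₗ[ℝ] TangentSpace 𝓘(ℝ, E) x →ₗ[ℝ] ℝ,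
      ∀ v w, B v w = g.inner x v w :=
  ⟨LinearMap.mk₂ ℝ (fun v w ↦ g.inner x v w)
      (fun v₁ v₂ w ↦ by rw [map_add]; rfl)
      (fun c v w ↦ by rw [map_smul]; rfl)
      (fun v w₁ w₂ ↦ map_add _ _ _)
      (fun c v w ↦ map_smul _ _ _),
    fun _ _ ↦ rfl⟩

/-- **Basis independence of the metric trace.** The tree's `metricTrace g x b` (the inverse-Gram
contraction in the basis `finBasis ℝ E`) equals `Σᵢⱼ (G_u⁻¹)ᵢⱼ b(uᵢ, uⱼ)`, `(G_u)ᵢⱼ = g_x(uᵢ, uⱼ)`,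
for EVERY basis `u` of `T_x M` (Kobayashi's contractions `Σ g^{αβ̄}(…)_{αβ̄}`, III.(1.6), are such
traces, written in an arbitrary frame). [cite: Kobayashi1987, III.(1.6)] -/
theorem metricTrace_eq_sum_basis {ι : Type*} [Fintype ι] [DecidableEq ι]
    (g : RiemannianMetric fun x : M ↦ TangentSpace 𝓘(ℝ, E) x) (x : M)
    (u : Basis ι ℝ (TangentSpace 𝓘(ℝ, E) x))
    (b : TangentSpace 𝓘(ℝ, E) x →ₗ[ℝ] TangentSpace 𝓘(ℝ, E) x →ₗ[ℝ] W) :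
    metricTrace g x (fun v w ↦ b v w) =
      ∑ i, ∑ j, (Matrix.of fun i j ↦ g.inner x (u i) (u j))⁻¹ i j • b (u i) (u j) := by
  classical
  obtain ⟨B, hB⟩ := exists_bilin_inner g x
  set v : Basis (Fin (finrank ℝ E)) ℝ (TangentSpace 𝓘(ℝ, E) x) := finBasis ℝ E with hv
  have hdet : IsUnit (Matrix.of fun j k ↦ B (v j) (v k)).det := by
    simp only [hB]
    exact isUnit_iff_ne_zero.2 (det_gram_ne_zero g x)
  have key := sum_inv_gram_smul_eq_of_basis B b v u hdet
  simp only [hB] at key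
  exact key

/-- **The metric trace in an orthonormal basis**: `tr_g b = Σₖ b(fₖ, fₖ)` for any
`g_x`-orthonormal basis `(fₖ)` of `T_x M` — the defining property announced in the docstring of
`metricTrace`, now proved (Voisin I §6.1.1: `Λ` via an orthonormal basis; Kobayashi III.(1.6) in a
unitary frame). [cite: VoisinHodgeI2002, §6.1.1] [cite: Kobayashi1987, III.(1.6)] -/
theorem metricTrace_eq_sum_of_orthonormal {ι : Type*} [Fintype ι] [DecidableEq ι]
    (g : RiemannianMetric fun x : M ↦ TangentSpace 𝓘(ℝ, E) x) (x : M)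
    (u : Basis ι ℝ (TangentSpace 𝓘(ℝ, E) x))
    (hu : ∀ i j, g.inner x (u i) (u j) = if i = j then 1 else 0)
    (b : TangentSpace 𝓘(ℝ, E) x →ₗ[ℝ] TangentSpace 𝓘(ℝ, E) x →ₗ[ℝ] W) :
    metricTrace g x (fun v w ↦ b v w) = ∑ i, b (u i) (u i) := by
  rw [metricTrace_eq_sum_basis g x u]
  have hG : (Matrix.of fun i j ↦ g.inner x (u i) (u j)) = 1 := by
    ext i j
    rw [Matrix.of_apply, hu, Matrix.one_apply]
  rw [hG, inv_one]
  refine Finset.sum_congr rfl fun i _ ↦ ?_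
  simp only [Matrix.one_apply, ite_smul, one_smul, zero_smul, Finset.sum_ite_eq, Finset.mem_univ,
    if_true]

omit [FiniteDimensional ℂ E] in
/-- A `g_x`-isometric linear endomorphism of `T_x M` is injective (`g_x(Av, Av) = g_x(v, v) > 0`
for `v ≠ 0`). [folklore] -/
private theorem injective_of_inner_map_map (g : RiemannianMetric fun x : M ↦ TangentSpace 𝓘(ℝ, E) x)
    (x : M) (A : TangentSpace 𝓘(ℝ, E) x →L[ℝ] TangentSpace 𝓘(ℝ, E) x)
    (hA : ∀ v w, g.inner x (A v) (A w) = g.inner x v w) : Function.Injective A := by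
  refine (injective_iff_map_eq_zero A).2 fun v hv ↦ ?_
  by_contra h0
  have h1 : 0 < g.inner x v v := g.pos x v h0
  have h2 : g.inner x (A v) (A v) = 0 := by rw [hv]; simp
  rw [hA] at h2
  exact h1.ne' h2

/-- **Invariance of the metric trace under isometries of the tangent space**: for a linear
`A : T_x M → T_x M` with `g_x(Av, Aw) = g_x(v, w)`, `tr_g b(A·, A·) = tr_g b` (an isometry maps
orthonormal frames to orthonormal frames; frame-independence of Kobayashi's contractions).
[cite: Kobayashi1987, III.(1.6)] -/
theorem metricTrace_comp_of_inner_map_map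
    (g : RiemannianMetric fun x : M ↦ TangentSpace 𝓘(ℝ, E) x) (x : M)
    (A : TangentSpace 𝓘(ℝ, E) x →L[ℝ] TangentSpace 𝓘(ℝ, E) x)
    (hA : ∀ v w, g.inner x (A v) (A w) = g.inner x v w)
    (b : TangentSpace 𝓘(ℝ, E) x →ₗ[ℝ] TangentSpace 𝓘(ℝ, E) x →ₗ[ℝ] W) :
    metricTrace g x (fun v w ↦ b (A v) (A w)) = metricTrace g x (fun v w ↦ b v w) := by
  classical
  obtain ⟨B, hB⟩ := exists_bilin_inner g x
  haveI : FiniteDimensional ℝ (TangentSpace 𝓘(ℝ, E) x) := inferInstanceAs (FiniteDimensional ℝ E)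
  set Ae : TangentSpace 𝓘(ℝ, E) x ≃ₗ[ℝ] TangentSpace 𝓘(ℝ, E) x :=
    LinearEquiv.ofInjectiveEndo (A : TangentSpace 𝓘(ℝ, E) x →ₗ[ℝ] TangentSpace 𝓘(ℝ, E) x)
      (injective_of_inner_map_map g x A hA) with hAe
  have hAe_apply : ∀ v, Ae v = A v := fun v ↦ rfl
  set v : Basis (Fin (finrank ℝ E)) ℝ (TangentSpace 𝓘(ℝ, E) x) := finBasis ℝ E with hv
  have hdet : IsUnit (Matrix.of fun j k ↦ B (v j) (v k)).det := by
    simp only [hB]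
    exact isUnit_iff_ne_zero.2 (det_gram_ne_zero g x)
  have key := sum_inv_gram_smul_map_eq B b v hdet Ae (fun y z ↦ by rw [hB, hB, hAe_apply, hAe_apply, hA])
  simp only [hB, hAe_apply] at key
  exact key

end MetricTraceBasis

end Literature.Geometry.Kaehler

/-! ## §2 Verbitsky's Lemma 2.1: `SU(2)`-invariant `2`-covectors are primitive for every `ω_L` -/

namespace Literature.Geometry.Hyperkaehler

open Literature.Geometry.Kaehler

section TwoCovectorBilin

variable {T : Type*} [AddCommGroup T] [Module ℝ T] [TopologicalSpace T]
  {W : Type*} [NormedAddCommGroup W] [NormedSpace ℝ W]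

/-- The bilinear map `(v, w) ↦ β(v, Lw)` attached to a `2`-covector `β` and an endomorphism `L`
(auxiliary packaging: its metric trace is `2 Λ_L β`). [folklore] -/
private theorem exists_bilin_apply₂ (β : T [⋀^Fin 2]→L[ℝ] W) (L : T →L[ℝ] T) :
    ∃ b : T →ₗ[ℝ] T →ₗ[ℝ] W, ∀ v w, b v w = β ![v, L w] :=
  ⟨LinearMap.mk₂ ℝ (fun v w ↦ β ![v, L w])
      (fun v v' w ↦ by rw [apply₂_add_left])
      (fun c v w ↦ by rw [apply₂_smul_left])
      (fun v w w' ↦ by rw [map_add, apply₂_add_right])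
      (fun c v w ↦ by rw [map_smul, apply₂_smul_right]),
    fun _ _ ↦ rfl⟩

/-- A `2`-covector vanishes on the diagonal. [folklore] -/
private theorem apply₂_self (β : T [⋀^Fin 2]→L[ℝ] W) (v : T) : β ![v, v] = 0 :=
  β.map_eq_zero_of_eq ![v, v] (i := 0) (j := 1) rfl (by decide)

end TwoCovectorBilin

section LemmaTwoOne

variable {E : Type*} [NormedAddCommGroup E] [NormedSpace ℂ E] [FiniteDimensional ℂ E]
  {M : Type*} [TopologicalSpace M] [ChartedSpace E M]
  {W : Type*} [NormedAddCommGroup W] [NormedSpace ℝ W]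
  {g : RiemannianMetric (fun x : M ↦ TangentSpace 𝓘(ℝ, E) x)}
  {J K : ∀ x : M, TangentSpace 𝓘(ℝ, E) x →L[ℝ] TangentSpace 𝓘(ℝ, E) x} {x : M}

/-- **The mechanism of Lemma 2.1.** Let `L, A` be endomorphisms of `T_x M` with `A` a
`g_x`-isometry ANTICOMMUTING with `L` (`AL = −LA`) and `β` an `A`-invariant `2`-covector
(`β(A·, A·) = β`). Then `tr_g β(·, L·) = 0`, i.e. `Λ_L β = 0`: indeed
`β(v, Lw) = β(Av, ALw) = −β(Av, LAw)`, so the trace equals minus itself by the invariance of the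
trace under the isometry `A`. (For `L` an induced complex structure and `A` a unit quaternion
orthogonal to it this is Verbitsky's "`ω_L` is orthogonal to the invariant forms".)
[cite: Verbitsky1996Hyperholomorphic, Lemma 2.1 (proof)] -/
theorem metricTrace_apply₂_eq_zero_of_anticommute (β : TangentSpace 𝓘(ℝ, E) x [⋀^Fin 2]→L[ℝ] W)
    (L A : TangentSpace 𝓘(ℝ, E) x →L[ℝ] TangentSpace 𝓘(ℝ, E) x)
    (hA : ∀ v w, g.inner x (A v) (A w) = g.inner x v w) (hAL : ∀ v, A (L v) = -L (A v))
    (hβ : ∀ v w, β ![A v, A w] = β ![v, w]) :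
    metricTrace g x (fun v w ↦ β ![v, L w]) = 0 := by
  obtain ⟨b, hb⟩ := exists_bilin_apply₂ β L
  have hfun : (fun v w : TangentSpace 𝓘(ℝ, E) x ↦ β ![v, L w]) = fun v w ↦ b v w := by
    funext v w; exact (hb v w).symm
  have hneg : (fun v w : TangentSpace 𝓘(ℝ, E) x ↦ b v w) = fun v w ↦ -b (A v) (A w) := by
    funext v w
    rw [hb, hb, ← hβ v (L w), hAL, apply₂_neg_right]
  have key : metricTrace g x (fun v w ↦ b v w) = -metricTrace g x (fun v w ↦ b v w) := by
    calc metricTrace g x (fun v w ↦ b v w)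
        = metricTrace g x (fun v w ↦ -b (A v) (A w)) := by rw [hneg]
      _ = -metricTrace g x (fun v w ↦ b (A v) (A w)) := by
          simp only [metricTrace, smul_neg, Finset.sum_neg_distrib]
      _ = -metricTrace g x (fun v w ↦ b v w) := by
          rw [metricTrace_comp_of_inner_map_map g x A hA b]
  rw [hfun]
  have h2 : (2 : ℝ) • metricTrace g x (fun v w ↦ b v w) = 0 := by
    rw [two_smul]
    nth_rewrite 2 [key]
    exact add_neg_cancel _
  exact (smul_eq_zero.1 h2).resolve_left two_ne_zero

/-- **Lemma 2.1 for `L = I`**: an `SU(2)`-invariant `2`-covector has `tr_g β(·, I·) = 0`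
(`Λ_I β = 0`; take `A = J`). [cite: Verbitsky1996Hyperholomorphic, Lemma 2.1] -/
theorem IsSU2InvariantAt.metricTrace_tangentJ_eq_zero (h : IsHyperkaehlerTriple g J K)
    {β : TangentSpace 𝓘(ℝ, E) x [⋀^Fin 2]→L[ℝ] W} (hβ : IsSU2InvariantAt J K x β) :
    metricTrace g x (fun v w ↦ β ![v, tangentJ E x w]) = 0 :=
  metricTrace_apply₂_eq_zero_of_anticommute β (tangentJ E x) (J x) (h.inner_J x)
    (fun v ↦ by rw [h.J_I, h.I_J]) hβ.apply_J

/-- **Lemma 2.1 for `L = J`**: `tr_g β(·, J·) = 0` (`Λ_J β = 0`; take `A = I`).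
[cite: Verbitsky1996Hyperholomorphic, Lemma 2.1] -/
theorem IsSU2InvariantAt.metricTrace_J_eq_zero (h : IsHyperkaehlerTriple g J K)
    {β : TangentSpace 𝓘(ℝ, E) x [⋀^Fin 2]→L[ℝ] W} (hβ : IsSU2InvariantAt J K x β) :
    metricTrace g x (fun v w ↦ β ![v, J x w]) = 0 :=
  metricTrace_apply₂_eq_zero_of_anticommute β (J x) (tangentJ E x) (h.isHermitian x)
    (fun v ↦ by rw [h.I_J, h.J_I, neg_neg]) hβ.apply_tangentJ

/-- **Lemma 2.1 for `L = K`**: `tr_g β(·, K·) = 0` (`Λ_K β = 0`; take `A = I`).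
[cite: Verbitsky1996Hyperholomorphic, Lemma 2.1] -/
theorem IsSU2InvariantAt.metricTrace_K_eq_zero (h : IsHyperkaehlerTriple g J K)
    {β : TangentSpace 𝓘(ℝ, E) x [⋀^Fin 2]→L[ℝ] W} (hβ : IsSU2InvariantAt J K x β) :
    metricTrace g x (fun v w ↦ β ![v, K x w]) = 0 :=
  metricTrace_apply₂_eq_zero_of_anticommute β (K x) (tangentJ E x) (h.isHermitian x)
    (fun v ↦ by rw [h.I_K, h.K_I]) hβ.apply_tangentJ

/-- **Verbitsky's Lemma 2.1 (pointwise, every induced structure).** For an `SU(2)`-invariant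
`2`-covector `β` on `T_x M` and EVERY `L = aI + bJ + cK` (no normalisation of `(a, b, c)` is
needed, by linearity): `tr_g β(·, L·) = 0` — "`Λ_L(Θ) = 0` for each induced complex structure
`L`". [cite: Verbitsky1996Hyperholomorphic, Lemma 2.1]
[cite: Verbitsky1997HyperholomorphicSheaves, §3.3] -/
theorem IsSU2InvariantAt.metricTrace_inducedJ_eq_zero (h : IsHyperkaehlerTriple g J K)
    {β : TangentSpace 𝓘(ℝ, E) x [⋀^Fin 2]→L[ℝ] W} (hβ : IsSU2InvariantAt J K x β) (a b c : ℝ) :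
    metricTrace g x (fun v w ↦ β ![v, inducedJ J K a b c x w]) = 0 := by
  have hfun : (fun v w : TangentSpace 𝓘(ℝ, E) x ↦ β ![v, inducedJ J K a b c x w]) =
      fun v w ↦ (a • β ![v, tangentJ E x w] + b • β ![v, J x w]) + c • β ![v, K x w] := by
    funext v w
    rw [inducedJ_apply, apply₂_add_right, apply₂_add_right, apply₂_smul_right, apply₂_smul_right,
      apply₂_smul_right]
  rw [hfun]
  calc metricTrace g x (fun v w ↦ (a • β ![v, tangentJ E x w] + b • β ![v, J x w]) +
        c • β ![v, K x w])
      = metricTrace g x (fun v w ↦ a • β ![v, tangentJ E x w] + b • β ![v, J x w]) +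
          metricTrace g x (fun v w ↦ c • β ![v, K x w]) :=
        metricTrace_add g x (fun v w ↦ a • β ![v, tangentJ E x w] + b • β ![v, J x w])
          (fun v w ↦ c • β ![v, K x w])
    _ = (metricTrace g x (fun v w ↦ a • β ![v, tangentJ E x w]) +
          metricTrace g x (fun v w ↦ b • β ![v, J x w])) +
          metricTrace g x (fun v w ↦ c • β ![v, K x w]) := by
        rw [metricTrace_add g x (fun v w ↦ a • β ![v, tangentJ E x w]) (fun v w ↦ b • β ![v, J x w])]
    _ = (a • metricTrace g x (fun v w ↦ β ![v, tangentJ E x w]) +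
          b • metricTrace g x (fun v w ↦ β ![v, J x w])) +
          c • metricTrace g x (fun v w ↦ β ![v, K x w]) := by
        rw [metricTrace_smul g x a (fun v w ↦ β ![v, tangentJ E x w]),
          metricTrace_smul g x b (fun v w ↦ β ![v, J x w]),
          metricTrace_smul g x c (fun v w ↦ β ![v, K x w])]
    _ = 0 := by
        rw [hβ.metricTrace_tangentJ_eq_zero h, hβ.metricTrace_J_eq_zero h,
          hβ.metricTrace_K_eq_zero h, smul_zero, smul_zero, smul_zero, add_zero, add_zero]

/-- **Lemma 2.1 in the tree's normalisation `Λ = MForm.contractKaehler`** (the contraction with the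
Kähler form `ω_I` of `g`, `Λβ = ½ tr_g β(·, I·)`): a `2`-form which is `SU(2)`-invariant at `x` has
`(Λβ)(x) = 0`. [cite: Verbitsky1996Hyperholomorphic, Lemma 2.1] -/
theorem IsSU2InvariantAt.contractKaehler_eq_zero (h : IsHyperkaehlerTriple g J K)
    {β : MForm 𝓘(ℝ, E) M W 2} (hβ : IsSU2InvariantAt J K x (β x)) : β.contractKaehler g x = 0 := by
  change (2⁻¹ : ℝ) • metricTrace g x (fun v w ↦ β x ![v, tangentJ E x w]) = 0
  rw [hβ.metricTrace_tangentJ_eq_zero h, smul_zero]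

/-- On a set: an `SU(2)`-invariant `2`-form `β` on `U` has `Λβ = 0` on `U`.
[cite: Verbitsky1996Hyperholomorphic, Lemma 2.1] -/
theorem IsSU2InvariantOn.contractKaehler_eq_zero (h : IsHyperkaehlerTriple g J K)
    {β : MForm 𝓘(ℝ, E) M W 2} {U : Set M} (hβ : IsSU2InvariantOn J K β U) {y : M} (hy : y ∈ U) :
    β.contractKaehler g y = 0 :=
  (hβ y hy).contractKaehler_eq_zero h

/-! ### The `(0,2)`-part of an invariant form vanishes -/

section ZeroTwo

variable {W' : Type*} [NormedAddCommGroup W'] [NormedSpace ℂ W']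

omit [FiniteDimensional ℂ E] in
/-- An `I`-invariant `2`-form (`β(I·, I·) = β`) has `J^*β = β` at the point. [folklore] -/
private theorem pullbackJ_apply_eq_of_apply_tangentJ {β : MForm 𝓘(ℝ, E) M W' 2}
    (hI : ∀ v w : TangentSpace 𝓘(ℝ, E) x, β x ![tangentJ E x v, tangentJ E x w] = β x ![v, w]) :
    β.pullbackJ x = β x := by
  ext v
  have hv : v = ![v 0, v 1] := by funext i; fin_cases i <;> rfl
  rw [MForm.pullbackJ_apply, hv]
  have h2 : (fun i ↦ tangentJ E x (![v 0, v 1] i)) = ![tangentJ E x (v 0), tangentJ E x (v 1)] := by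
    funext i; fin_cases i <;> rfl
  rw [h2, hI]

omit [FiniteDimensional ℂ E] in
/-- An `I`-invariant `2`-form is annihilated by the derivation action `Q` of `I`
(`β(Iv, w) + β(v, Iw) = 0`, since `β(Iv, w) = β(I²v, Iw) = −β(v, Iw)`). [folklore] -/
private theorem derivJ_apply_eq_zero_of_apply_tangentJ {β : MForm 𝓘(ℝ, E) M W' 2}
    (hI : ∀ v w : TangentSpace 𝓘(ℝ, E) x, β x ![tangentJ E x v, tangentJ E x w] = β x ![v, w]) :
    β.derivJ x = 0 := by
  ext v
  have hv : v = ![v 0, v 1] := by funext i; fin_cases i <;> rfl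
  rw [hv, MForm.derivJ_apply, ContinuousAlternatingMap.coe_zero, Pi.zero_apply]
  have h1 := hI (tangentJ E x (v 0)) (v 1)
  rw [tangentJ_tangentJ, apply₂_neg_left] at h1
  rw [← h1, neg_add_cancel]

omit [FiniteDimensional ℂ E] in
/-- **The `(0,2)`-part of an `SU(2)`-invariant `2`-form vanishes** at the point (it is of type
`(1,1)` for `I`): `β^{0,2}(x) = ¼(β − J^*β + iQβ)(x) = 0`. [cite: Verbitsky1996Hyperholomorphic, Prop. 1.2] -/
theorem IsSU2InvariantAt.zeroTwoPart_apply_eq_zero {β : MForm 𝓘(ℝ, E) M W' 2}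
    (hβ : IsSU2InvariantAt J K x (β x)) : β.zeroTwoPart x = 0 := by
  change (4⁻¹ : ℂ) • (β x - β.pullbackJ x + Complex.I • β.derivJ x) = 0
  rw [pullbackJ_apply_eq_of_apply_tangentJ hβ.apply_tangentJ,
    derivJ_apply_eq_zero_of_apply_tangentJ hβ.apply_tangentJ, sub_self, smul_zero, add_zero,
    smul_zero]

end ZeroTwo

end LemmaTwoOne

/-! ## §3 Verbitsky's Theorem 2.3: a hyperholomorphic connection is Yang–Mills, `ΛΘ = 0` -/

section TheoremTwoThree

variable {E : Type*} [NormedAddCommGroup E] [NormedSpace ℂ E] [FiniteDimensional ℂ E]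
  {M : Type*} [TopologicalSpace M] [ChartedSpace E M]
  {F : Type*} [NormedAddCommGroup F] [InnerProductSpace ℂ F] [FiniteDimensional ℂ F]
  {V : M → Type*} [TopologicalSpace (TotalSpace F V)] [∀ x, TopologicalSpace (V x)]
  [∀ x, AddCommGroup (V x)] [∀ x, Module ℂ (V x)] [FiberBundle F V] [VectorBundle ℂ F V]
  {g : RiemannianMetric (fun x : M ↦ TangentSpace 𝓘(ℝ, E) x)}
  {J K : ∀ x : M, TangentSpace 𝓘(ℝ, E) x →L[ℝ] TangentSpace 𝓘(ℝ, E) x}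

/-- **Theorem 2.3 (Verbitsky): a hyperholomorphic connection is Yang–Mills with `Λ(Θ) = 0`.** For a
hyperholomorphic unitary connection `D` on the Hermitian bundle `(V, h)` over the hyperkähler
manifold `(M, g, I, J, K)`, Kobayashi's mean curvature `K = iΛΩ` (the tree's
`UnitaryConnection.meanCurvature`, computed at each point in the frame of the atlas at that point)
vanishes identically. [cite: Verbitsky1996Hyperholomorphic, Thm. 2.3]
[cite: Verbitsky1997HyperholomorphicSheaves, §3.3] -/
theorem _root_.Literature.Geometry.Kaehler.UnitaryConnection.IsHyperholomorphic.meanCurvature_eq_zero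
    {h : HermitianStructure V} {D : UnitaryConnection E F h} (hT : IsHyperkaehlerTriple g J K)
    (hD : D.IsHyperholomorphic J K) : D.meanCurvature g = 0 := by
  funext x
  have hx : IsSU2InvariantAt J K x (D.curvature x x) :=
    hD x x (FiberBundle.mem_baseSet_trivializationAt F V x)
  change (Complex.I / 2) • (D.curvature x).contractKaehler g x = 0
  rw [hx.contractKaehler_eq_zero hT, smul_zero]

/-- The scalar curvature `σ = tr K` of a hyperholomorphic unitary connection vanishes.
[cite: Verbitsky1996Hyperholomorphic, Thm. 2.3] -/
theorem _root_.Literature.Geometry.Kaehler.UnitaryConnection.IsHyperholomorphic.scalarCurvature_eq_zero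
    {h : HermitianStructure V} {D : UnitaryConnection E F h} (hT : IsHyperkaehlerTriple g J K)
    (hD : D.IsHyperholomorphic J K) : D.scalarCurvature g = 0 := by
  funext x
  simp [UnitaryConnection.scalarCurvature, hD.meanCurvature_eq_zero hT]

/-- The Einstein defect `|K − 0·I|²_h` of a hyperholomorphic unitary connection vanishes: `D` is
Einstein–Hermitian (Hermitian–Yang–Mills) with constant `0`. [cite: Verbitsky1996Hyperholomorphic, Thm. 2.3] -/
theorem _root_.Literature.Geometry.Kaehler.UnitaryConnection.IsHyperholomorphic.einsteinDefectNormSq_zero_eq_zero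
    {h : HermitianStructure V} {D : UnitaryConnection E F h} (hT : IsHyperkaehlerTriple g J K)
    (hD : D.IsHyperholomorphic J K) : D.einsteinDefectNormSq g 0 = 0 := by
  funext x
  simp [UnitaryConnection.einsteinDefectNormSq, hD.meanCurvature_eq_zero hT, endNormSq_zero]

omit [FiniteDimensional ℂ E] in
/-- The `(0,2)`-part of the curvature of a hyperholomorphic unitary connection vanishes at every
point of each frame domain, in particular in the frame at the point itself.
[cite: Verbitsky1996Hyperholomorphic, Thm. 2.1 and Def. 2.1] -/
theorem _root_.Literature.Geometry.Kaehler.UnitaryConnection.IsHyperholomorphic.curvatureZeroTwo_apply_eq_zero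
    {h : HermitianStructure V} {D : UnitaryConnection E F h} (hD : D.IsHyperholomorphic J K)
    {x₀ x : M} (hx : x ∈ (trivializationAt F V x₀).baseSet) : D.curvatureZeroTwo x₀ x = 0 :=
  (hD x₀ x hx).zeroTwoPart_apply_eq_zero

/-- The pointwise squared norm `|Ω^{0,2}|²` of a hyperholomorphic unitary connection vanishes.
[cite: Verbitsky1996Hyperholomorphic, Thm. 2.1 and Def. 2.1] -/
theorem _root_.Literature.Geometry.Kaehler.UnitaryConnection.IsHyperholomorphic.curvatureZeroTwoNormSq_eq_zero
    {h : HermitianStructure V} {D : UnitaryConnection E F h} (hD : D.IsHyperholomorphic J K) :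
    D.curvatureZeroTwoNormSq g = 0 := by
  funext x
  have h0 : D.curvatureZeroTwo x x = 0 :=
    hD.curvatureZeroTwo_apply_eq_zero (FiberBundle.mem_baseSet_trivializationAt F V x)
  simp only [UnitaryConnection.curvatureZeroTwoNormSq, h0, ContinuousAlternatingMap.coe_zero,
    Pi.zero_apply, endNormSq_zero, Finset.sum_const_zero, mul_zero]

variable [IsManifold 𝓘(ℝ, E) 1 M] [T3Space M] [MeasurableSpace M] [BorelSpace M] {n : ℕ∞ω}

/-- Kobayashi's Einstein constant of a hyperholomorphic unitary connection is `0` (its scalar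
curvature vanishes identically). [cite: Verbitsky1996Hyperholomorphic, Thm. 2.3] -/
theorem _root_.Literature.Geometry.Kaehler.UnitaryConnection.IsHyperholomorphic.einsteinConstant_eq_zero
    {h : HermitianStructure V} {D : UnitaryConnection E F h}
    {g : ContMDiffRiemannianMetric 𝓘(ℝ, E) n E (fun x : M ↦ TangentSpace 𝓘(ℝ, E) x)}
    (hT : IsHyperkaehlerTriple g.toRiemannianMetric J K) (hD : D.IsHyperholomorphic J K) :
    D.einsteinConstant g = 0 := by
  simp [UnitaryConnection.einsteinConstant, hD.scalarCurvature_eq_zero hT]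

/-- **The holomorphic (Hermitian–Yang–Mills) defect of a hyperholomorphic unitary connection is
`0`**: `‖Ω^{0,2}‖² + ‖K − c·I‖² = 0` — the connection is integrable and Einstein–Hermitian with
constant `c = 0` (Verbitsky's Thm. 2.3 "hyperholomorphic ⇒ Yang–Mills, `Λ(Θ) = 0`" in the tree's
`L²` bookkeeping `UnitaryConnection.holomorphicDefect`). [cite: Verbitsky1996Hyperholomorphic, Thm. 2.3] -/
theorem _root_.Literature.Geometry.Kaehler.UnitaryConnection.IsHyperholomorphic.holomorphicDefect_eq_zero
    {h : HermitianStructure V} {D : UnitaryConnection E F h}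
    {g : ContMDiffRiemannianMetric 𝓘(ℝ, E) n E (fun x : M ↦ TangentSpace 𝓘(ℝ, E) x)}
    (hT : IsHyperkaehlerTriple g.toRiemannianMetric J K) (hD : D.IsHyperholomorphic J K) :
    D.holomorphicDefect g = 0 := by
  simp [UnitaryConnection.holomorphicDefect, hD.curvatureZeroTwoNormSq_eq_zero,
    hD.einsteinConstant_eq_zero hT, hD.einsteinDefectNormSq_zero_eq_zero hT]

/-- **A Hermitian bundle carrying a hyperholomorphic unitary connection is (approximately)
Hermitian–Yang–Mills** for the hyperkähler metric: the infimum of the holomorphic defects over its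
unitary connections is attained, with value `0`, at the hyperholomorphic one (and `g` is Kähler).
[cite: Verbitsky1996Hyperholomorphic, Thm. 2.3] -/
theorem _root_.Literature.Geometry.Kaehler.HermitianStructure.isApproxHermitianYangMills_of_isHyperholomorphic
    {h : HermitianStructure V} {D : UnitaryConnection E F h}
    {g : ContMDiffRiemannianMetric 𝓘(ℝ, E) n E (fun x : M ↦ TangentSpace 𝓘(ℝ, E) x)}
    (hT : IsHyperkaehlerTriple g.toRiemannianMetric J K) (hD : D.IsHyperholomorphic J K) :
    h.IsApproxHermitianYangMills F g := by
  refine ⟨hT.isKaehler, le_antisymm ?_ zero_le⟩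
  exact (iInf_le _ D).trans (le_of_eq (hD.holomorphicDefect_eq_zero hT))

omit [IsManifold 𝓘(ℝ, E) 1 M] [T3Space M] [MeasurableSpace M] [BorelSpace M] in
/-- **Theorem 2.3 for Chern connections.** The Chern connection of a Hermitian holomorphic bundle
whose curvature is `SU(2)`-invariant (`HermitianHolomorphicBundle.IsHyperholomorphic`) is
Einstein–Hermitian with constant `0`: `K = iΛΩ = 0` in every holomorphic frame of the atlas
(`IsHermitianEinstein g 0`, Kobayashi IV.§1; = Hermitian–Yang–Mills with `λ = 0`).
[cite: Verbitsky1996Hyperholomorphic, Thm. 2.3] [cite: Kobayashi1987, IV.§1 (p. 99)] -/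
theorem _root_.Literature.Geometry.Kaehler.HermitianHolomorphicBundle.IsHyperholomorphic.isHermitianEinstein_zero
    [IsManifold 𝓘(ℂ, E) ω M] [ContMDiffVectorBundle ω F V 𝓘(ℂ, E)]
    {hB : HermitianHolomorphicBundle E F V} (hT : IsHyperkaehlerTriple g J K)
    (hh : hB.IsHyperholomorphic J K) : hB.IsHermitianEinstein g 0 := by
  intro x₀ x hx
  have hinv : IsSU2InvariantAt J K x (hB.curvatureForm x₀ x) := hh x₀ x hx
  change (Complex.I / 2) • (hB.curvatureForm x₀).contractKaehler g x =
    (((0 : ℝ) : ℝ) : ℂ) • ContinuousLinearMap.id ℂ F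
  rw [hinv.contractKaehler_eq_zero hT, smul_zero, Complex.ofReal_zero, zero_smul]

end TheoremTwoThree

/-! ## §4 The surface criterion (proof of Verbitsky's Theorem 2.4; Muñoz §3.1):
## on a hyperkähler surface the `SU(2)`-invariant `2`-covectors are exactly the primitive `(1,1)`-covectors -/

section Surface

variable {E : Type*} [NormedAddCommGroup E] [NormedSpace ℂ E] [FiniteDimensional ℂ E]
  {M : Type*} [TopologicalSpace M] [ChartedSpace E M]
  {W : Type*} [NormedAddCommGroup W] [NormedSpace ℝ W]
  {g : RiemannianMetric (fun x : M ↦ TangentSpace 𝓘(ℝ, E) x)}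
  {J K : ∀ x : M, TangentSpace 𝓘(ℝ, E) x →L[ℝ] TangentSpace 𝓘(ℝ, E) x}

namespace IsHyperkaehlerTriple

omit [FiniteDimensional ℂ E] in
/-- `g(Iv, w) = −g(v, Iw)` (`g` is Hermitian for `I`, `I² = −1`). [cite: Huybrechts2016K3, Ch. 7 §3.2] -/
theorem inner_tangentJ_left (h : IsHyperkaehlerTriple g J K) (x : M) (v w : TangentSpace 𝓘(ℝ, E) x) :
    g.inner x (tangentJ E x v) w = -g.inner x v (tangentJ E x w) := by
  have e := h.isHermitian x v (tangentJ E x w)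
  rw [tangentJ_tangentJ, map_neg] at e
  linarith

omit [FiniteDimensional ℂ E] in
/-- `g(Jv, w) = −g(v, Jw)` (`g` is Hermitian for `J`, `J² = −1`). [cite: Huybrechts2016K3, Ch. 7 §3.2] -/
theorem inner_J_left (h : IsHyperkaehlerTriple g J K) (x : M) (v w : TangentSpace 𝓘(ℝ, E) x) :
    g.inner x (J x v) w = -g.inner x v (J x w) := by
  have e := h.inner_J x v (J x w)
  rw [h.J_J, map_neg] at e
  linarith

omit [FiniteDimensional ℂ E] in
/-- `g(Kv, w) = −g(v, Kw)` (`g` is Hermitian for `K`, `K² = −1`). [cite: Huybrechts2016K3, Ch. 7 §3.2] -/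
theorem inner_K_left (h : IsHyperkaehlerTriple g J K) (x : M) (v w : TangentSpace 𝓘(ℝ, E) x) :
    g.inner x (K x v) w = -g.inner x v (K x w) := by
  have e := h.inner_K x v (K x w)
  rw [h.K_K, map_neg] at e
  linarith

omit [FiniteDimensional ℂ E] in
/-- `g(v, Iv) = 0` (`ω_I` is alternating). [cite: Huybrechts2016K3, Ch. 7 §3.2] -/
theorem inner_self_tangentJ (h : IsHyperkaehlerTriple g J K) (x : M) (v : TangentSpace 𝓘(ℝ, E) x) :
    g.inner x v (tangentJ E x v) = 0 := by
  have e := h.inner_tangentJ_left x v v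
  rw [g.symm x] at e
  linarith

omit [FiniteDimensional ℂ E] in
/-- `g(v, Jv) = 0` (`ω_J` is alternating). [cite: Huybrechts2016K3, Ch. 7 §3.2] -/
theorem inner_self_J (h : IsHyperkaehlerTriple g J K) (x : M) (v : TangentSpace 𝓘(ℝ, E) x) :
    g.inner x v (J x v) = 0 := by
  have e := h.inner_J_left x v v
  rw [g.symm x] at e
  linarith

omit [FiniteDimensional ℂ E] in
/-- `g(v, Kv) = 0` (`ω_K` is alternating). [cite: Huybrechts2016K3, Ch. 7 §3.2] -/
theorem inner_self_K (h : IsHyperkaehlerTriple g J K) (x : M) (v : TangentSpace 𝓘(ℝ, E) x) :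
    g.inner x v (K x v) = 0 := by
  have e := h.inner_K_left x v v
  rw [g.symm x] at e
  linarith

/-- **A quaternionic orthonormal frame on a hyperkähler surface.** If `dim_ℂ M = 2`, every real
tangent space carries a `g_x`-orthonormal basis of the form `(e, Ie, Je, Ke)` (any unit vector `e`;
the real tangent space is a one-dimensional quaternionic Hermitian space).
[cite: Munoz2015RotationComplexStructures, §3.1] [cite: Huybrechts2016K3, Ch. 7 §3.2] -/
theorem exists_quaternionic_orthonormal_basis (h : IsHyperkaehlerTriple g J K)
    (h2 : finrank ℂ E = 2) (x : M) :
    ∃ (e : TangentSpace 𝓘(ℝ, E) x) (u : Basis (Fin 4) ℝ (TangentSpace 𝓘(ℝ, E) x)),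
      ⇑u = ![e, tangentJ E x e, J x e, K x e] ∧
        ∀ i j, g.inner x (u i) (u j) = if i = j then 1 else 0 := by
  have h4 : finrank ℝ (TangentSpace 𝓘(ℝ, E) x) = 4 := by
    change finrank ℝ E = 4
    rw [finrank_real_of_complex, h2]
  haveI : FiniteDimensional ℝ (TangentSpace 𝓘(ℝ, E) x) := inferInstanceAs (FiniteDimensional ℝ E)
  obtain ⟨v, hv⟩ : ∃ v : TangentSpace 𝓘(ℝ, E) x, v ≠ 0 :=
    (Module.finrank_pos_iff_exists_ne_zero (R := ℝ)).1 (by rw [h4]; norm_num)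
  have hpos : 0 < g.inner x v v := g.pos x v hv
  set r : ℝ := (Real.sqrt (g.inner x v v))⁻¹ with hr
  set e : TangentSpace 𝓘(ℝ, E) x := r • v with he
  have hee : g.inner x e e = 1 := by
    have h1 : g.inner x e e = r * (r * g.inner x v v) := by
      have a1 : g.inner x e = r • g.inner x v := by rw [he, map_smul]
      have a2 : g.inner x e e = r * g.inner x v e := by rw [a1]; rfl
      rw [a2, he, map_smul, smul_eq_mul]
    rw [h1, hr, ← mul_assoc, ← mul_inv, Real.mul_self_sqrt hpos.le, inv_mul_cancel₀ hpos.ne']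
  -- the orthonormality table of the frame `(e, Ie, Je, Ke)`
  have hI := h.isHermitian x
  have t01 : g.inner x e (tangentJ E x e) = 0 := h.inner_self_tangentJ x e
  have t02 : g.inner x e (J x e) = 0 := h.inner_self_J x e
  have t03 : g.inner x e (K x e) = 0 := h.inner_self_K x e
  have t11 : g.inner x (tangentJ E x e) (tangentJ E x e) = 1 := by rw [hI, hee]
  have t22 : g.inner x (J x e) (J x e) = 1 := by rw [h.inner_J, hee]
  have t33 : g.inner x (K x e) (K x e) = 1 := by rw [h.inner_K, hee]
  have t12 : g.inner x (tangentJ E x e) (J x e) = 0 := by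
    rw [h.inner_tangentJ_left, h.I_J, t03, neg_zero]
  have t13 : g.inner x (tangentJ E x e) (K x e) = 0 := by
    rw [h.inner_tangentJ_left, h.I_K, map_neg, t02, neg_neg]  -- g e (-(J e))
  have t23 : g.inner x (J x e) (K x e) = 0 := by
    rw [h.inner_J_left, h.J_K, t01, neg_zero]
  have t10 : g.inner x (tangentJ E x e) e = 0 := by rw [g.symm x, t01]
  have t20 : g.inner x (J x e) e = 0 := by rw [g.symm x, t02]
  have t30 : g.inner x (K x e) e = 0 := by rw [g.symm x, t03]
  have t21 : g.inner x (J x e) (tangentJ E x e) = 0 := by rw [g.symm x, t12]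
  have t31 : g.inner x (K x e) (tangentJ E x e) = 0 := by rw [g.symm x, t13]
  have t32 : g.inner x (K x e) (J x e) = 0 := by rw [g.symm x, t23]
  set fr : Fin 4 → TangentSpace 𝓘(ℝ, E) x := ![e, tangentJ E x e, J x e, K x e] with hfr
  have table : ∀ i j, g.inner x (fr i) (fr j) = if i = j then 1 else 0 := by
    intro i j
    fin_cases i <;> fin_cases j <;>
      simp [hfr, hee, t01, t02, t03, t11, t22, t33, t12, t13, t23, t10, t20, t30, t21, t31, t32]
  have hli : LinearIndependent ℝ fr := by
    rw [Fintype.linearIndependent_iff]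
    intro c hc i
    have key : g.inner x (fr i) (∑ j, c j • fr j) = c i := by
      rw [map_sum]
      simp only [map_smul, smul_eq_mul, table]
      simp
    rw [hc, map_zero] at key
    exact key.symm
  have hcard : Fintype.card (Fin 4) = finrank ℝ (TangentSpace 𝓘(ℝ, E) x) := by
    rw [Fintype.card_fin, h4]
  refine ⟨e, basisOfLinearIndependentOfCardEqFinrank hli hcard, ?_, fun i j ↦ ?_⟩
  · rw [coe_basisOfLinearIndependentOfCardEqFinrank]
  · rw [coe_basisOfLinearIndependentOfCardEqFinrank]
    exact table i j

/-- **The surface criterion** ("if `M` is a surface then `P^⊥` is the bundle of `G_M`-invariant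
`2`-forms", proof of Verbitsky's Thm. 2.4; Muñoz §3.1: `Λ² = ⟨ω_I, ω_J, ω_K⟩ ⊕ Δ^{1,1}_{I,prim}`). On
a hyperkähler SURFACE (`dim_ℂ M = 2`) a `W`-valued `2`-covector is `SU(2)`-invariant — of type
`(1,1)` for every induced complex structure — if and only if it is of type `(1,1)` for `I` and
primitive: `β(I·, I·) = β` and `tr_g β(·, I·) = 0` (`Λ_I β = 0`). (`⇒` is Lemma 2.1 and holds in
every dimension; `⇐` is the computation in a quaternionic frame `(e, Ie, Je, Ke)` and FAILS in
higher dimension.) [cite: Verbitsky1996Hyperholomorphic, Thm. 2.4 (proof)]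
[cite: Munoz2015RotationComplexStructures, §3.1] -/
theorem isSU2InvariantAt_iff_of_finrank_eq_two (h : IsHyperkaehlerTriple g J K)
    (h2 : finrank ℂ E = 2) (x : M) (β : TangentSpace 𝓘(ℝ, E) x [⋀^Fin 2]→L[ℝ] W) :
    IsSU2InvariantAt J K x β ↔
      (∀ v w : TangentSpace 𝓘(ℝ, E) x, β ![tangentJ E x v, tangentJ E x w] = β ![v, w]) ∧
        metricTrace g x (fun v w ↦ β ![v, tangentJ E x w]) = 0 := by
  refine ⟨fun hβ ↦ ⟨hβ.apply_tangentJ, hβ.metricTrace_tangentJ_eq_zero h⟩, fun ⟨hI, hΛ⟩ ↦ ?_⟩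
  classical
  obtain ⟨e, u, hu, hon⟩ := h.exists_quaternionic_orthonormal_basis h2 x
  -- the trace in the frame: `2 β(e, Ie) + 2 β(Je, Ke) = 0`
  obtain ⟨b, hb⟩ := exists_bilin_apply₂ β (tangentJ E x)
  have hfun : (fun v w : TangentSpace 𝓘(ℝ, E) x ↦ β ![v, tangentJ E x w]) = fun v w ↦ b v w := by
    funext v w; exact (hb v w).symm
  rw [hfun, metricTrace_eq_sum_of_orthonormal g x u hon b] at hΛ
  simp only [Fin.sum_univ_four, hb, hu, Matrix.cons_val_zero, Matrix.cons_val_one,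
    Matrix.cons_val] at hΛ
  -- names for the values of `β` on the frame
  have hswap := apply₂_swap β
  -- relations from `I`-invariance
  have rIK : β ![tangentJ E x e, K x e] = β ![e, J x e] := by
    rw [← h.I_J x e, hI]
  have rIJ : β ![tangentJ E x e, J x e] = -β ![e, K x e] := by
    have e1 : J x e = tangentJ E x (-(K x e)) := by rw [map_neg, h.I_K, neg_neg]
    rw [e1, hI, apply₂_neg_right]
  -- relation from primitivity
  have rJK : β ![J x e, K x e] = -β ![e, tangentJ E x e] := by
    rw [tangentJ_tangentJ, h.I_J, h.I_K, apply₂_neg_right, apply₂_neg_right, hswap e,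
      hswap (J x e) (K x e)] at hΛ
    -- hΛ : β![e,Ie] - -β![e,Ie]... normalise
    have : (2 : ℝ) • (β ![J x e, K x e] + β ![e, tangentJ E x e]) = 0 := by
      rw [two_smul]; rw [← hΛ]; abel
    have h0 : β ![J x e, K x e] + β ![e, tangentJ E x e] = 0 :=
      (smul_eq_zero.1 this).resolve_left two_ne_zero
    exact eq_neg_of_add_eq_zero_left h0
  -- `J`-invariance on the frame
  have frame : ∀ i j : Fin 4, β ![J x (u i), J x (u j)] = β ![u i, u j] := by
    intro i j
    have hJI : J x (tangentJ E x e) = -K x e := h.J_I x e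
    have hJJ : J x (J x e) = -e := h.J_J x e
    have hJK : J x (K x e) = tangentJ E x e := h.J_K x e
    fin_cases i <;> fin_cases j <;>
      simp [hu, hJI, hJJ, hJK, apply₂_neg_left, apply₂_neg_right, apply₂_self, rIK, rIJ, rJK,
        hswap e (tangentJ E x e), hswap e (J x e), hswap e (K x e),
        hswap (tangentJ E x e) (J x e), hswap (tangentJ E x e) (K x e), hswap (J x e) (K x e)]
  have hJ : ∀ v w : TangentSpace 𝓘(ℝ, E) x, β ![J x v, J x w] = β ![v, w] := by
    have hext : (β.compContinuousLinearMap (J x)).toContinuousMultilinearMap.toMultilinearMap =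
        β.toContinuousMultilinearMap.toMultilinearMap := by
      refine Basis.ext_multilinear (fun _ : Fin 2 ↦ u) fun v ↦ ?_
      have hv : (fun i ↦ u (v i)) = ![u (v 0), u (v 1)] := by
        funext i; fin_cases i <;> rfl
      change β.compContinuousLinearMap (J x) (fun i ↦ u (v i)) = β (fun i ↦ u (v i))
      rw [hv, compContinuousLinearMap_apply₂, frame]
    intro v w
    have key := congrArg (fun φ : MultilinearMap ℝ (fun _ : Fin 2 ↦ TangentSpace 𝓘(ℝ, E) x) W ↦
      φ ![v, w]) hext
    change β.compContinuousLinearMap (J x) ![v, w] = β ![v, w] at key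
    rwa [compContinuousLinearMap_apply₂] at key
  exact h.isSU2InvariantAt_of_apply_tangentJ_of_apply_J x hI hJ

end IsHyperkaehlerTriple

/-- **Verbitsky's Theorem 2.4 minus Uhlenbeck–Yau: on a hyperkähler surface, Einstein–Hermitian with
constant `0` ⟺ hyperholomorphic.** For the Chern connection of a Hermitian holomorphic bundle over a
hyperkähler SURFACE `(M, g, I, J, K)`, `dim_ℂ M = 2`: the curvature is `SU(2)`-invariant iff
`K = iΛΩ = 0` (the curvature is of type `(1,1)` for `I` by construction, and on a surface
`(1,1) + primitive = SU(2)`-invariant). With Uhlenbeck–Yau (every stable bundle of degree `0` has an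
Einstein–Hermitian metric, NOT proved here) this is Thm. 2.4: stable bundles of degree `0` on a K3 or
abelian surface are hyperholomorphic. [cite: Verbitsky1996Hyperholomorphic, Thm. 2.4]
[cite: Munoz2015RotationComplexStructures, §3.1] -/
theorem _root_.Literature.Geometry.Kaehler.HermitianHolomorphicBundle.isHyperholomorphic_iff_isHermitianEinstein_zero
    {F : Type*} [NormedAddCommGroup F] [InnerProductSpace ℂ F] [FiniteDimensional ℂ F]
    {V : M → Type*} [TopologicalSpace (TotalSpace F V)] [∀ x, TopologicalSpace (V x)]
    [∀ x, AddCommGroup (V x)] [∀ x, Module ℂ (V x)] [FiberBundle F V] [VectorBundle ℂ F V]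
    [IsManifold 𝓘(ℂ, E) ω M] [ContMDiffVectorBundle ω F V 𝓘(ℂ, E)]
    (hT : IsHyperkaehlerTriple g J K) (h2 : finrank ℂ E = 2) (hB : HermitianHolomorphicBundle E F V) :
    hB.IsHyperholomorphic J K ↔ hB.IsHermitianEinstein g 0 := by
  refine ⟨fun hh ↦ hh.isHermitianEinstein_zero hT, fun hHE x₀ x hx ↦ ?_⟩
  rw [hT.isSU2InvariantAt_iff_of_finrank_eq_two h2 x]
  refine ⟨apply_tangentJ_of_pullbackJ_eq (hB.pullbackJ_curvatureForm x₀) x, ?_⟩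
  have hK : (Complex.I / 2) • ((2⁻¹ : ℝ) •
      metricTrace g x (fun v w ↦ hB.curvatureForm x₀ x ![v, tangentJ E x w])) =
      (((0 : ℝ) : ℝ) : ℂ) • ContinuousLinearMap.id ℂ F := hHE x₀ x hx
  rw [Complex.ofReal_zero, zero_smul] at hK
  rcases smul_eq_zero.1 hK with h0 | h0
  · exact absurd h0 (div_ne_zero Complex.I_ne_zero two_ne_zero)
  rcases smul_eq_zero.1 h0 with h1 | h1
  · norm_num at h1
  · exact h1

end Surface

end Literature.Geometry.Hyperkaehler

end
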